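import Mathlib
import HarnessLib
import Summits.CriticalPhenomena.PercolationContinuityZ3.Theses.PercDustRigidity
import Literature.Probability.Percolation.UniquenessInsertionTolerant

/-!
# `PercDustRigidity`: split glue `NoInfinitelyFragileGiant → SieveCoarsening → DustRigidity`
(route `PercDustRigidity`, glue item `stmt-CriticalPhenomena-18906` `DustRigiditySplitGlue` of the
crux-strategist BC2 redirect of the deciding crux `DustRigidity`, item `stmt-CriticalPhenomena-9591`;
pieces `NoInfinitelyFragileGiant` = `stmt-CriticalPhenomena-18885`, `SieveCoarsening` =
`stmt-CriticalPhenomena-18902`)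

`DustRigidity` (X): every probability measure `μ` on bond configurations of `ℤ³` with the nine
hypotheses (H1)–(H9) (lattice support, shift invariance, ergodicity, insertion tolerance, deletion
tolerance, ergodicity under every non-zero shift, automorphism invariance, positive association,
a.s. finite coordinate half-space clusters) which is DUST-FRAGILE (some density-zero `S ⊆ D₁` kills
every infinite cluster: a.s. all clusters of `ω \ S` are finite) does not percolate.

Write `D_k = {s(y, y + e₃) : 2^k ∣ y_i ∀ i}` (the level-`k` plug sieve; `D₁ ⊇ D₂ ⊇ …`) and
`Death_μ(T) :⇔ μ-a.s. every cluster of ω \ T is finite` (monotone in `T`). The split runs along the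
waypoint `∀ k ≥ 1, Death_μ(D_k)`:

* `NoInfinitelyFragileGiant` (X₁): (H1)–(H9) + a.s. uniqueness of the infinite cluster +
  `∀ k ≥ 1, Death_μ(D_k)` ⟹ `μ(0 ↔ ∞) = 0`;
* `SieveCoarsening` (X₂): (H1)–(H9) + a.s. uniqueness + `Death_μ(D_k)` ⟹ `Death_μ(D_{k+1})` (`k ≥ 1`).

**Assembly** (`dustRigidity_of_subs`): Burton–Keane uniqueness for insertion-tolerant ergodic
measures (`ae_numInfiniteClusters_le_one_of_isInsertionTolerantErgodic`, fed by (H1)–(H4))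
discharges the uniqueness hypothesis of both pieces; the dust clause gives `Death_μ(D_1)` by cluster
monotonicity (`openCluster_mono`, `S ⊆ D₁ = D_1` after `2 ^ 1 = 2`); induction on the level
(`Nat.le_induction`) with X₂ gives `Death_μ(D_k)` for every `k ≥ 1`; X₁ concludes. The closing
theorem is `splitGlue_proof : DustRigiditySplitGlue`. (Verbatim the strategist's
`Cruxes/DustRigidity/SplitAssembly.lean`, commit ac28e81a6767, with the two pieces now the route's
decls.)

Sources: R. M. Burton, M. Keane, Comm. Math. Phys. 121 (1989) 501–505 (uniqueness for stationary
finite-energy measures); R. Lyons, Y. Peres, *Probability on Trees and Networks* (2016), Ch. 7–8;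
G. Grimmett, *Percolation* (1999), §3.3 (plug sieves / essential diminishments).
-/

noncomputable section

namespace Summit.CriticalPhenomena.PercolationContinuityZ3.Theorems

open MeasureTheory Filter Set
open Summit.CriticalPhenomena.PercolationContinuityZ3.Theses.PercDustRigidity

/-- **Assembly of the split**: `NoInfinitelyFragileGiant → SieveCoarsening → DustRigidity`.
[folklore] -/
theorem dustRigidity_of_subs (hN : NoInfinitelyFragileGiant) (hC : SieveCoarsening) : DustRigidity := by
  intro μ hμ h1 h2 h3 h4 h5 h6 h7 h8 h9 hdust
  obtain ⟨S, hS, -, hdeath⟩ := hdust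
  -- (1) Burton–Keane: (H1)–(H4) are the hypotheses `IsInsertionTolerantErgodic μ`
  have hITE : Literature.Probability.Percolation.IsInsertionTolerantErgodic μ :=
    { ae_subset_edgeSet := h1
      measure_preimage_shift := fun v _ hS' => h2 v _ hS'
      zero_one := fun hS' hinv => h3 _ hS' hinv
      insertion_tolerant := fun N => by
        obtain ⟨c, hc, hcS⟩ := h4 N
        exact ⟨c, hc, fun hS' => hcS _ hS'⟩ }
  have hU : ∀ᵐ ω ∂μ, Literature.Probability.Percolation.numInfiniteClusters ω ≤ 1 :=
    Literature.Probability.Percolation.ae_numInfiniteClusters_le_one_of_isInsertionTolerantErgodic hITE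
  -- (2) dust-fragility ⇒ death off the whole level-1 sieve (cluster monotonicity, `S ⊆ D₁ = D_1`)
  have hSD : S ⊆ {e | ∃ y : Literature.Probability.LatticeModels.Site 3,
      (∀ i, (2 ^ 1 : ℤ) ∣ y i) ∧ e = s(y, y + Pi.single (2 : Fin 3) 1)} := by
    intro e he
    obtain ⟨y, hy, rfl⟩ := hS he
    exact ⟨y, fun i => by simpa using hy i, rfl⟩
  have hD1 : ∀ᵐ ω ∂μ, ∀ x : Literature.Probability.LatticeModels.Site 3,
      (Literature.Probability.Percolation.openCluster (ω \ {e | ∃ y : Literature.Probability.LatticeModels.Site 3,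
        (∀ i, (2 ^ 1 : ℤ) ∣ y i) ∧ e = s(y, y + Pi.single (2 : Fin 3) 1)}) x).Finite := by
    filter_upwards [hdeath] with ω hω x
    exact (hω x).subset (Literature.Probability.Percolation.openCluster_mono (sdiff_le_sdiff_left hSD) x)
  -- (3) induction on the level with X₂
  have hall : ∀ k : ℕ, 1 ≤ k → ∀ᵐ ω ∂μ, ∀ x : Literature.Probability.LatticeModels.Site 3,
      (Literature.Probability.Percolation.openCluster (ω \ {e | ∃ y : Literature.Probability.LatticeModels.Site 3,
        (∀ i, (2 ^ k : ℤ) ∣ y i) ∧ e = s(y, y + Pi.single (2 : Fin 3) 1)}) x).Finite := by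
    intro k hk
    induction k, hk using Nat.le_induction with
    | base => exact hD1
    | succ k hk ih => exact hC μ hμ h1 h2 h3 h4 h5 h6 h7 h8 h9 hU k hk ih
  -- (4) X₁ concludes
  exact hN μ hμ h1 h2 h3 h4 h5 h6 h7 h8 h9 hU hall


/-- The glue item `DustRigiditySplitGlue` (`stmt-CriticalPhenomena-18906`) of route `PercDustRigidity`,
closed by the assembly. [folklore] -/
theorem splitGlue_proof : DustRigiditySplitGlue := fun h1 h2 => dustRigidity_of_subs h1 h2

end Summit.CriticalPhenomena.PercolationContinuityZ3.Theorems
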